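import Literature.Computability.Complexity.Transducers
import Literature.Computability.Complexity.Classes
import Literature.Computability.Complexity.TimeBoundsProofs
import HarnessLib

/-!
# Stub `stub_preimageFST` of line `Sketch` (xp-ladder-middle-bits), crux `PermanentNotInP` (stmt-PneNP-16143)

Generic TM2 plumbing for the precision ladder of the route `PermanentDescent`: a `DTIME(n^c)`
language pulled back along a length-non-increasing finite-state transduction `T.eval` is in
`DTIME(n^(c+1))`.

Proof: `T.eval` is computed in linear time `(T.maxEmit + 1) · n + 3`
(`FST.timeComputable_eval`); the sequential composite with a decider of `V`
(`Turing.TM2ComputableAux.comp_outputsWithin`) decides `{w | T.eval w ∈ V}` (the indicators agree,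
`Set.mem_iff_boolIndicator`) within `(b · |T.eval w|^c + b) + ((maxEmit + 1) · n + 3)` steps, which
is at most `K · n^(c+1) + K` for `K = 2b + maxEmit + 4` (`|T.eval w| ≤ n`, `n ≤ n^(c+1)` and
`n^c ≤ n^(c+1)` for `n ≥ 1`, the length `0` absorbed by the additive constant). This is the pattern
of `Literature.Computability.Complexity.preimage_mem_DTIME_id` one exponent up.

References: S. Arora, B. Barak, *Computational Complexity: A Modern Approach*, CUP 2009, §1.3
(composition of machines), Claim 2.4.
-/

-- the single-problem summit repeats `PneNP.PneNP` in module path and namespace (justified lint debt)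
set_option linter.dupNamespace false

namespace Summit.PneNP.PneNP.Theorems.XpLadder

open Literature.Computability.Complexity

/-- The exponent bookkeeping of the composite machine: with `m ≤ n` (output length of the
transducer at most the input length), `b · m^c + b + ((E + 1) · n + 3) ≤ K · n^(c+1) + K` for
`K = 2b + E + 4`. [folklore] -/
private theorem comp_time_le (b E c n m : ℕ) (hm : m ≤ n) :
    b * m ^ c + b + ((E + 1) * n + 3) ≤ (2 * b + E + 4) * n ^ (c + 1) + (2 * b + E + 4) := by
  have hpow : m ^ c ≤ n ^ c := Nat.pow_le_pow_left hm c
  rcases Nat.eq_zero_or_pos n with rfl | hn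
  · obtain rfl : m = 0 := Nat.le_zero.mp hm
    rcases c with _ | c <;> simp <;> omega
  · have h1 : n ^ c ≤ n ^ (c + 1) := Nat.pow_le_pow_right hn (Nat.le_succ c)
    have h2 : n ≤ n ^ (c + 1) := by
      calc n = n ^ 1 := (pow_one n).symm
        _ ≤ n ^ (c + 1) := Nat.pow_le_pow_right hn (Nat.succ_le_succ (Nat.zero_le c))
    nlinarith

/-- **`DTIME(n^c)` pulled back along a length-non-increasing finite-state transduction lands in
`DTIME(n^(c+1))`.** For a finite-state transducer `T` over `{0,1}` with `|T.eval w| ≤ |w|` and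
`V ∈ DTIME(n^c)`, the preimage `{w | T.eval w ∈ V}` is in `DTIME(n^(c+1))`: run the transducer
(linear time, `FST.timeComputable_eval`), then the decider of `V` on its output
(`Turing.TM2ComputableAux.comp_outputsWithin`); the exponent `c + 1` absorbs the linear phase and
is independent of `T`. [cite: AroraBarak2009, §1.3 (composition of machines)] -/
theorem stub_preimageFST :
    ∀ {σ : Type} [Fintype σ] (T : Literature.Computability.Complexity.FST σ Bool Bool)
      {V : Language Bool} {c : ℕ},
      (∀ w : List Bool, (T.eval w).length ≤ w.length) →
      V ∈ Literature.Computability.Complexity.DTIME (fun n => n ^ c) →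
      ({w | T.eval w ∈ V} : Language Bool) ∈
        Literature.Computability.Complexity.DTIME (fun n => n ^ (c + 1)) := by
  intro σ _ T V c hlen hV
  obtain ⟨F, hF⟩ := T.timeComputable_eval
  obtain ⟨b, hdec⟩ := hV
  obtain ⟨M, hM⟩ := (hdec : TimeDecidable id V fun n => b * n ^ c + b)
  refine ⟨2 * b + T.maxEmit + 4, F.comp M, fun w => ?_⟩
  have h₁ := hF w
  have h₂ := hM (T.eval w)
  have hind : ({w | T.eval w ∈ V} : Language Bool).boolIndicator w = V.boolIndicator (T.eval w) := by
    have h1 : ∀ (s : Set (List Bool)) (v : List Bool), s.boolIndicator v = true ↔ v ∈ s :=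
      fun s v => (Set.mem_iff_boolIndicator s v).symm
    rw [Bool.eq_iff_iff, h1, h1]
    rfl
  simp only [id] at h₁ h₂ ⊢
  rw [hind]
  exact (Turing.TM2ComputableAux.comp_outputsWithin _ _ h₁ h₂).mono
    (comp_time_le b T.maxEmit c w.length (T.eval w).length (hlen w))

end Summit.PneNP.PneNP.Theorems.XpLadder
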